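import Mathlib.Algebra.Group.Units.Basic
import Mathlib.CategoryTheory.SingleObj
import Mathlib.CategoryTheory.Iso
import HarnessLib
import Literature.IUT.HodgeTheaters.GlobalFrobenioidsKummer

/-!
# [IUTchI] §5, Corollary 5.3 (i), Remarks 5.2.2, 5.3.2, 5.3.3: rigidity of global Frobenioids

Mochizuki, *Inter-universal Teichmüller theory I*, §5: Corollary 5.3 (i) p. 144, Remark 5.2.2 p. 143,
Remarks 5.3.2, 5.3.3 p. 146, kurims manuscript (May 2020)
([IUTchI] Cor 5.3 (i) p.144) [claim: Mochizuki2012, status: disputed].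

* Cor 5.3 (i): "the natural map `Isom(¹ℱ^⊛, ²ℱ^⊛) → Isom(Base(¹ℱ^⊛), Base(²ℱ^⊛))` (respectively, … `ℱ^⊚` …) is
  bijective" — a named `Prop` statement over a minimal hypothesis kit for the global Frobenioids
  `†ℱ^⊛ ⊇ †ℱ^⊚` of Example 5.1 (iii) (abc-iut-L5-t1's `GlobalFrobenioids*.lean`: `GlobalFrobenioid`,
  `NFBridgeRecon`; TODO-merge:abc-iut-L5-t1) — never asserted;
* Rmk 5.2.2 ("`ℱ`-prime-strips are Kummer-ready …, `ℱ^⊢`-prime-strips are Kummer-blind")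
  (`primeStripKummerStatus`, over abc-iut-L5-t1's landed `KummerStatus` / `kummerStatus` of Rmk 5.1.3);
* Rmk 5.3.2 (the rigidity of Cor 5.3 (iv) "may be regarded as being essentially a consequence of the
  'Kummer-readiness' of the tempered Frobenioid") — expository, recorded here;
* Rmk 5.3.3 — the correction to [FrdI] Prop 5.6 — PROVED as the abstract unit computation it is
  (`FrdI_prop56_units`).
-/

namespace Literature.IUT.HodgeTheaters

open CategoryTheory

universe u

/-! ### Remark 5.3.3: the correction to [FrdI] Proposition 5.6 — PROVED -/

/-- **Rmk 5.3.3** ("We take this opportunity to rectify a minor oversight in [FrdI]. The hypothesis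
that the Frobenioids under consideration be of unit-profinite type in [FrdI], Proposition 5.6 — hence
also in [FrdI], Corollary 5.7, (iii) — may be removed. Indeed, if, in the notation of the proof of
[FrdI], Proposition 5.6, one writes `φ′_p = c_p · φ_p`, where `c_p ∈ 𝒪^×(A)`, for `p ∈ 𝔓𝔯𝔦𝔪𝔢𝔰`, then one
has `c_2 · c_p^2 · φ_2 · φ_p = c_2 · φ_2 · c_p · φ_p = φ′_2 · φ′_p = φ′_p · φ′_2 = c_p · φ_p · c_2 · φ_2 = c_p · c_2^p · φ_p · φ_2
= c_p · c_2^p · φ_2 · φ_p` — so `c_2 · c_p^2 = c_p · c_2^p`, i.e., `c_p = c_2^{p−1}`, for `p ∈ 𝔓𝔯𝔦𝔪𝔢𝔰`. Thus,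
`φ′_p = c_2^{−1} · φ_p · c_2`", [IUTchI] Rmk 5.3.3 p. 146), as the abstract computation: in a monoid
with commuting elements `φ_2`, `φ_p`, commuting units `c_2`, `c_p` satisfying the two Frobenius relations
actually used (`φ_2 · c_p = c_p^2 · φ_2`, `φ_p · c_2 = c_2^p · φ_p` — in [FrdI] these hold for `c ∈ 𝒪^×(A)`,
not for every unit of `End(A)`), units cancellable against `φ_2 · φ_p` (unique unit-factorisation), and
commuting `φ′_2 = c_2 φ_2`, `φ′_p = c_p φ_p`, one has `c_2 c_p^2 = c_p c_2^p`, `c_p = c_2^{p−1}` and `φ′_p = c_2^{−1} φ_p c_2`. PROVED.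
([IUTchI] Rmk 5.3.3 p.146) [claim: Mochizuki2012, status: disputed] -/
theorem FrdI_prop56_units {M : Type*} [Monoid M] (p : ℕ) (hp : 0 < p) (φ₂ φp : M) (c₂ cp : Mˣ)
    (frob₂ : φ₂ * cp = ((cp ^ 2 : Mˣ) : M) * φ₂) (frobp : φp * c₂ = ((c₂ ^ p : Mˣ) : M) * φp)
    (hφ : φ₂ * φp = φp * φ₂) (hc : c₂ * cp = cp * c₂)
    (hreg : ∀ c c' : Mˣ, (c : M) * (φ₂ * φp) = c' * (φ₂ * φp) → c = c')
    (hφ' : ((c₂ : M) * φ₂) * ((cp : M) * φp) = ((cp : M) * φp) * ((c₂ : M) * φ₂)) :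
    c₂ * cp ^ 2 = cp * c₂ ^ p ∧ cp = c₂ ^ (p - 1) ∧ (cp : M) * φp = (c₂⁻¹ : Mˣ) * φp * c₂ := by
  -- the displayed chain of equalities, read as `(c₂ cp²)·(φ₂ φp) = (cp c₂^p)·(φ₂ φp)`
  have key : ((c₂ * cp ^ 2 : Mˣ) : M) * (φ₂ * φp) = ((cp * c₂ ^ p : Mˣ) : M) * (φ₂ * φp) := by
    have lhs : ((c₂ : M) * φ₂) * ((cp : M) * φp) = ((c₂ * cp ^ 2 : Mˣ) : M) * (φ₂ * φp) := by
      rw [Units.val_mul, mul_assoc (c₂ : M), ← mul_assoc φ₂, frob₂]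
      simp only [mul_assoc]
    have rhs : ((cp : M) * φp) * ((c₂ : M) * φ₂) = ((cp * c₂ ^ p : Mˣ) : M) * (φ₂ * φp) := by
      rw [Units.val_mul, mul_assoc (cp : M), ← mul_assoc φp, frobp, hφ]
      simp only [mul_assoc]
    rw [← lhs, ← rhs, hφ']
  have h1 : c₂ * cp ^ 2 = cp * c₂ ^ p := hreg _ _ key
  -- `c_p = c₂^{p-1}`: cancel in the (commutative) subgroup generated by `c₂`, `cp`
  have e : c₂ ^ p = c₂ * c₂ ^ (p - 1) := by
    rw [← pow_succ', Nat.sub_add_cancel hp]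
  have h2 : c₂ * (cp * cp) = c₂ * (cp * c₂ ^ (p - 1)) := by
    calc c₂ * (cp * cp) = c₂ * cp ^ 2 := by rw [pow_two]
      _ = cp * c₂ ^ p := h1
      _ = (cp * c₂) * c₂ ^ (p - 1) := by rw [e, mul_assoc]
      _ = (c₂ * cp) * c₂ ^ (p - 1) := by rw [hc]
      _ = c₂ * (cp * c₂ ^ (p - 1)) := by rw [mul_assoc]
  have hcp : cp = c₂ ^ (p - 1) := mul_left_cancel (mul_left_cancel h2)
  refine ⟨h1, hcp, ?_⟩
  -- `φ′_p = c₂⁻¹ φ_p c₂`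
  rw [hcp, mul_assoc, frobp, ← mul_assoc, ← Units.val_mul]
  congr 2
  rw [eq_inv_mul_iff_mul_eq, ← e]

namespace PMBaseKit

/-! ### Remark 5.2.2: prime-strips are Kummer-ready / Kummer-blind -/

/-- The two kinds of prime-strips compared in Remark 5.2.2 ([IUTchI] Rmk 5.2.2 p. 143).
([IUTchI] Rmk 5.2.2 p.143) [claim: Mochizuki2012, status: disputed] -/
inductive PrimeStripKind
  /-- `ℱ`-prime-strips (Def 5.2 (i)) -/
  | F
  /-- `ℱ^⊢`-prime-strips (Def 5.2 (ii)) -/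
  | Fvdash
  deriving DecidableEq

/-- **Rmk 5.2.2**: "`ℱ`-prime-strips are Kummer-ready [cf. Remark 5.1.3], whereas `ℱ^⊢`-prime-strips are
Kummer-blind" — "the Frobenioid `ℱ̲_v` may be reconstructed category-theoretically from `𝒞̲_v`
[cf. Remark 3.2.1 (ii)]; a similar statement holds for `𝒞_v`, `ℱ_v` when `v ∈ 𝕍^good`. By contrast, [no]
analogous statement holds for `ℱ^⊢_v, 𝒞^⊢_v`" ([IUTchI] Rmk 5.2.2 p. 143); the statuses are abc-iut-L5-t1's
landed `KummerStatus` (`GlobalFrobenioidsKummer.lean`, whose `kummerStatus` records the ten objects of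
Rmk 5.1.3). ([IUTchI] Rmk 5.2.2 p.143) [claim: Mochizuki2012, status: disputed] -/
def primeStripKummerStatus : PrimeStripKind → KummerStatus
  | .F => .ready
  | .Fvdash => .blind

/-! ### Corollary 5.3 (i) over a hypothesis kit for `†ℱ^⊛ ⊇ †ℱ^⊚` -/

/-- TODO-merge:abc-iut-L5-t1 Example 5.1 (iii). **Hypothesis kit for the global Frobenioids of
Example 5.1**: the coarsified category of categories ([IUTchI] §0 p. 33), the model global Frobenioids
`†ℱ^⊛` ("any category equivalent to `ℱ^⊛(†𝒟^⊚)`") and `†ℱ^⊚ := †ℱ^⊛|_{†𝒟^⊚}` ([IUTchI] Ex 5.1 (iii) pp. 125–126;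
abc-iut-L5-t1's `GlobalFrobenioid`), and the base-category operation "write `Base(†ℱ^⊛)` for the base
category of this Frobenioid" ([FrdI] Cor 4.11, Thm 6.4 (i)) with its functoriality on isomorphisms.
([IUTchI] Ex 5.1 (iii) p.125) [claim: Mochizuki2012, status: disputed] -/
structure S5GlobalLocal where
  /-- the ambient category of (small) categories and isomorphism classes of functors (§0 p. 33) -/
  CatAmb : Type u
  /-- category structure -/
  [catAmb : Category.{u} CatAmb]
  /-- TODO-merge:abc-iut-L5-t1 Ex 5.1 (iii): the model `†ℱ^⊛` -/
  FglobModel : CatAmb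
  /-- TODO-merge:abc-iut-L5-t1 Ex 5.1 (iii): the model `†ℱ^⊚ = †ℱ^⊛|_{†𝒟^⊚}` -/
  FnfModel : CatAmb
  /-- `Base(−)`: the base category of (an isomorph of) a global Frobenioid -/
  base : CatAmb → CatAmb
  /-- "the natural map `Isom(¹ℱ, ²ℱ) → Isom(Base(¹ℱ), Base(²ℱ))` [cf. [FrdI], Corollary 4.11; [FrdI],
  Theorem 6.4, (i)]" ([IUTchI] Cor 5.3 (i) p. 144) -/
  baseMap : ∀ {Y₁ Y₂ : CatAmb}, (Y₁ ≅ Y₂) → (base Y₁ ≅ base Y₂)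

attribute [instance] S5GlobalLocal.catAmb

/-- **Cor 5.3 (i)**: "For `i = 1, 2`, let `ⁱℱ^⊛` (respectively, `ⁱℱ^⊚`) be a category which is equivalent
to the category `†ℱ^⊛` (respectively, `†ℱ^⊚`) of Example 5.1, (iii) … Then the natural map
`Isom(¹ℱ^⊛, ²ℱ^⊛) → Isom(Base(¹ℱ^⊛), Base(²ℱ^⊛))` (respectively, `Isom(¹ℱ^⊚, ²ℱ^⊚) → Isom(Base(¹ℱ^⊚), Base(²ℱ^⊚))`)
… is bijective" ([IUTchI] Cor 5.3 (i) p. 144; proof: category-theoreticity of `𝕄^⊛(†𝒟^⊚) ⥲ †𝕄^⊛`,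
Ex 5.1 (v), (vi)) — named statement, NOT asserted.
([IUTchI] Cor 5.3 (i) p.144) [claim: Mochizuki2012, status: disputed] -/
def S5GlobalLocal.IsomGlobalToBaseBijective (G : S5GlobalLocal.{u}) : Prop :=
  (∀ Y₁ Y₂ : G.CatAmb, Nonempty (Y₁ ≅ G.FglobModel) → Nonempty (Y₂ ≅ G.FglobModel) →
      Function.Bijective (G.baseMap (Y₁ := Y₁) (Y₂ := Y₂))) ∧
    ∀ Y₁ Y₂ : G.CatAmb, Nonempty (Y₁ ≅ G.FnfModel) → Nonempty (Y₂ ≅ G.FnfModel) →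
      Function.Bijective (G.baseMap (Y₁ := Y₁) (Y₂ := Y₂))

/-- **Rmk 5.3.2**: "Just as in the case of Corollary 5.3, (i), (ii), the rigidity property of Corollary
5.3, (iv), may be regarded as being essentially a consequence of the 'Kummer-readiness' [cf. Remarks
5.1.3, 5.2.2] of the tempered Frobenioid `ℱ̲_v`" ([IUTchI] Rmk 5.3.2 p. 146): recorded as the
classification of the tempered Frobenioid as Kummer-ready.
([IUTchI] Rmk 5.3.2 p.146) [claim: Mochizuki2012, status: disputed] -/
def temperedFrobenioidKummerStatus : KummerStatus := .ready

/-! ### Consistency: a model of `S5GlobalLocal` -/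

/-- A model of the global-Frobenioid kit: the one-object category on the trivial monoid, `Base = id`
— witnessing that `S5GlobalLocal` has honest inhabitants (for it `IsomGlobalToBaseBijective` holds
trivially) ([IUTchI] Ex 5.1 (iii) p. 125). ([IUTchI] Ex 5.1 (iii) p.125) [claim: Mochizuki2012, status: disputed] -/
def S5GlobalLocal.toy : S5GlobalLocal.{0} where
  CatAmb := SingleObj Unit
  FglobModel := SingleObj.star _
  FnfModel := SingleObj.star _
  base Y := Y
  baseMap φ := φ

end PMBaseKit

end Literature.IUT.HodgeTheaters
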